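import Mathlib
import Summits.Ventures.HodgeRepro.Tier4.Common.LocalTorus
import Summits.Ventures.HodgeRepro.Tier4.Common.LocalTorusCompact
import Summits.Ventures.HodgeRepro.Tier4.Line1.FiniteLevelIsolation
import Summits.Ventures.HodgeRepro.Tier4.Line1.AdelicParts
import Summits.Ventures.HodgeRepro.Tier4.Common.CompactOpenLevel
import Summits.Ventures.HodgeRepro.Tier4.Line4.FinitePlacePositivity
import Summits.Ventures.HodgeRepro.Tier4.Line4.CentreCocompact
import Summits.Ventures.HodgeRepro.Tier4.Line4.LineScalars

/-!
# Tier4/Line4/CentralScalars — norm-one `E′`-scalars are central unitaries; the finite part and the centre; compact matrix sets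

Blind re-derivation cell `pub-hodge-repro`, Tier 4 «PROVE THE STEP» (README §9–§10), LINE L4, cut C-L4-PROPER
(t4-plan-4 g3 S14566, statement S14602), seat t4-L2-p3 (gen 4); module 2 of 4.

* a norm-one scalar `esc x y` is a unit with conjugate inverse `esc x (−y)`; the inverse of a torus-type element is the
  conjugate decomposition (`mat_inv_of_decomp`);
* **`escGA`**: the element of `U(W)(𝔸)` with matrix `x + yΩ`, `x² + d y² = 1` (unitary by `Ω B = −B Ωᵀ`); it lies in the
  centre `Z = T ∩ T′ ∩ Z(G)` (`escGA_mem_centre`, via L1-p3's `mem_center_of_mat_eq_scalar`);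
* the bridge `g ∈ G(𝔸_f) ↔ infM (mat g) = 1` (`mem_finitePart_iff_infM`), `ofFinPart g ∈ G(𝔸_f)`; with typer-2's
  `ofFinPart_mem_centre` (CentreCocompact p697526, by name) `(esc x′ y′)_f` is the central element of `T_f` that
  normalises the pairs in C-L4-PROPER;
* **`isCompact_setOf_mat_mem`**: `{g : mat g ∈ K, mat g⁻¹ ∈ K′}` is compact for compact `K`, `K′` (typer-2's closed
  embedding `g ↦ (g, g⁻¹)`, `isClosedEmbedding_embed`); the scalar algebra of the decompositions (`decomp_mul_esc`,
  `esc_mul_decomp_conj`).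

Mathlib + the line's landed modules only; no printed input; nothing here asserts anything about the truth of (P);
HC_CM is NOT proved by anyone in this repository.
-/

set_option autoImplicit false

noncomputable section

namespace Summit.Ventures.HodgeRepro.Tier4.Line4

open Summit.Ventures.HodgeRepro.Tier4 Summit.Ventures.HodgeRepro.Tier4.Common
  Summit.Ventures.HodgeRepro.Tier4.Line1 Matrix NumberField IsDedekindDomain
open scoped Pointwise NumberField

variable {k : Type} [Field k] [NumberField k] (W : PlaneData k)

/-! ## 4. Norm-one scalars are units with conjugate inverse; they are central unitaries -/

section Units

/-- `esc x (−y)` is a two-sided inverse of `esc x y` when the norm is `1` -/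
theorem esc_mul_esc_conj_eq_one {d : k} (hΩ : W.Ω * W.Ω = -(d • (1 : Matrix (Fin 4) (Fin 4) k)))
    {x y : Ad k} (h : nrm d x y = 1) : esc W x y * esc W x (-y) = 1 := by
  rw [esc_mul_esc_conj W hΩ, h, one_smul]

/-- `esc x (−y)` is a left inverse of `esc x y` when the norm is `1` -/
theorem esc_conj_mul_esc_eq_one {d : k} (hΩ : W.Ω * W.Ω = -(d • (1 : Matrix (Fin 4) (Fin 4) k)))
    {x y : Ad k} (h : nrm d x y = 1) : esc W x (-y) * esc W x y = 1 := by
  have h' : nrm d x (-y) = 1 := by simpa only [nrm, neg_mul_neg] using h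
  simpa only [neg_neg] using esc_mul_esc_conj_eq_one W hΩ h'

/-- **the inverse of a torus-type element is the conjugate decomposition**: if `mat b = Σ esc x_i y_i P_i` with all
norms `1`, then `mat b⁻¹ = Σ esc x_i (−y_i) P_i`. -/
theorem mat_inv_of_decomp {d : k} (hΩ : W.Ω * W.Ω = -(d • (1 : Matrix (Fin 4) (Fin 4) k)))
    (P : Fin 2 → Matrix (Fin 4) (Fin 4) k) (hPΩ : ∀ i, P i * W.Ω = W.Ω * P i)
    (hPi : ∀ i, P i * P i = P i) (hsum : P 0 + P 1 = 1) (x y : Fin 2 → Ad k) (hn : ∀ i, nrm d (x i) (y i) = 1)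
    {b : GA W} (hb : GA.mat W b = esc W (x 0) (y 0) * adMat k (P 0) + esc W (x 1) (y 1) * adMat k (P 1)) :
    GA.mat W b⁻¹ = esc W (x 0) (-y 0) * adMat k (P 0) + esc W (x 1) (-y 1) * adMat k (P 1) := by
  set X : M4 k := esc W (x 0) (-y 0) * adMat k (P 0) + esc W (x 1) (-y 1) * adMat k (P 1) with hX
  have hterm : ∀ i j : Fin 2, (esc W (x i) (y i) * adMat k (P i)) * (esc W (x j) (-y j) * adMat k (P j)) =
      if i = j then adMat k (P i) else 0 := by
    intro i j
    calc (esc W (x i) (y i) * adMat k (P i)) * (esc W (x j) (-y j) * adMat k (P j))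
        = esc W (x i) (y i) * (adMat k (P i) * esc W (x j) (-y j)) * adMat k (P j) := by simp only [mul_assoc]
      _ = esc W (x i) (y i) * esc W (x j) (-y j) * (adMat k (P i) * adMat k (P j)) := by
          rw [← esc_mul_adMat_comm W _ _ (hPΩ i)]
          simp only [mul_assoc]
      _ = _ := by
        by_cases hij : i = j
        · subst hij
          rw [if_pos rfl, esc_mul_esc_conj_eq_one W hΩ (hn i), one_mul, ← adMat_mul, hPi i]
        · rw [if_neg hij, ← adMat_mul, mul_eq_zero_of_ne P hPi hsum hij, adMat_zero, mul_zero]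
  have hbX : GA.mat W b * X = 1 := by
    rw [hb, hX, add_mul, mul_add, mul_add, hterm 0 0, hterm 0 1, hterm 1 0, hterm 1 1]
    simp only [if_true, if_neg (show (0 : Fin 2) ≠ 1 by decide), if_neg (show (1 : Fin 2) ≠ 0 by decide),
      add_zero, zero_add, ← adMat_add, hsum, adMat_one]
  calc GA.mat W b⁻¹ = GA.mat W b⁻¹ * (GA.mat W b * X) := by rw [hbX, mul_one]
    _ = X := by rw [← mul_assoc, GA.mat_inv_mul, one_mul]

/-- **the adelic unitary of a norm-one `E′`-scalar**: `x + yΩ` with `x² + d y² = 1` lies in `U(W)(𝔸)`. -/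
def escGA {d : k} (hΩ : W.Ω * W.Ω = -(d • (1 : Matrix (Fin 4) (Fin 4) k)))
    (hΩB : W.Ω * W.B = -(W.B * W.Ωᵀ)) (x y : Ad k) (h : nrm d x y = 1) : GA W :=
  ⟨⟨esc W x y, esc W x (-y), esc_mul_esc_conj_eq_one W hΩ h, esc_conj_mul_esc_eq_one W hΩ h⟩, by
    refine ⟨esc_mul_adMat_comm W x y rfl, ?_⟩
    change esc W x y * adMat k W.B * (esc W x y)ᵀ = adMat k W.B
    have h0 : W.B * W.Ωᵀ = -(W.Ω * W.B) := by rw [hΩB, neg_neg]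
    have h1 : adMat k W.B * adMat k W.Ωᵀ = -(adMat k W.Ω * adMat k W.B) := by
      rw [← adMat_mul, ← adMat_mul, h0, adMat_neg]
    have hBT : adMat k W.B * (esc W x y)ᵀ = esc W x (-y) * adMat k W.B := by
      rw [esc_transpose, esc, mul_add, add_mul, mul_smul_comm, mul_smul_comm, mul_one, smul_mul_assoc,
        smul_mul_assoc, one_mul, h1, smul_neg, neg_smul]
    rw [mul_assoc, hBT, ← mul_assoc, esc_mul_esc_conj_eq_one W hΩ h, one_mul]⟩

/-- the matrix of `escGA x y` is `esc x y` -/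
theorem mat_escGA {d : k} (hΩ : W.Ω * W.Ω = -(d • (1 : Matrix (Fin 4) (Fin 4) k)))
    (hΩB : W.Ω * W.B = -(W.B * W.Ωᵀ)) (x y : Ad k) (h : nrm d x y = 1) :
    GA.mat W (escGA W hΩ hΩB x y h) = esc W x y := rfl

/-- a norm-one scalar is CENTRAL: in `T`, in `T′` and in the centre of `U(W)(𝔸)`. -/
theorem escGA_mem_centre {d : k} (hΩ : W.Ω * W.Ω = -(d • (1 : Matrix (Fin 4) (Fin 4) k)))
    (hΩB : W.Ω * W.B = -(W.B * W.Ωᵀ)) (x y : Ad k) (h : nrm d x y = 1) :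
    escGA W hΩ hΩB x y h ∈ centre W := by
  refine ⟨⟨⟨?_, ?_⟩, ⟨?_, ?_⟩⟩, ?_⟩
  · exact esc_mul_adMat_comm W x y (W.P_comm 0)
  · exact esc_mul_adMat_comm W x y (W.P_comm 1)
  · exact esc_mul_adMat_comm W x y (W.Q_comm 0)
  · exact esc_mul_adMat_comm W x y (W.Q_comm 1)
  · exact mem_center_of_mat_eq_scalar W _ (mat_escGA W hΩ hΩB x y h)

end Units

/-! ## 7. The finite part: the bridge `g ∈ G(𝔸_f) ↔ infM (mat g) = 1`, and `ofFinPart` preserves the centre -/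

section FinitePartBridge

/-- **`g ∈ G(𝔸_f)` iff the archimedean part of its matrix is the identity** -/
theorem mem_finitePart_iff_infM (g : GA W) : g ∈ finitePart W ↔ infM k (GA.mat W g) = 1 := by
  rw [mem_finitePart]
  constructor
  · intro h
    ext i j
    funext w
    have hij := (infiniteComponent_eq_one_iff W w g).1 (h w) i j
    change (GA.mat W g i j).1 w = _ at hij
    change (GA.mat W g i j).1 w = (1 : Matrix (Fin 4) (Fin 4) (InfiniteAdeleRing k)) i j w
    rw [hij]
    simp only [Matrix.one_apply]
    split_ifs <;> rfl
  · intro h w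
    rw [infiniteComponent_eq_one_iff]
    intro i j
    have hij := congrFun (congrFun h i) j
    simp only [infM, Matrix.map_apply] at hij
    change (GA.mat W g i j).1 = _ at hij
    change (GA.mat W g i j).1 w = _
    rw [hij]
    simp only [Matrix.one_apply]
    split_ifs <;> rfl

/-- the finite part of any element lies in `G(𝔸_f)` -/
theorem ofFinPart_mem_finitePart' (g : GA W) : GA.ofFinPart W g ∈ finitePart W := by
  rw [mem_finitePart_iff_infM, GA.mat_ofFinPart, infM_mixM]

/-- the finite part is additive -/
theorem finM_add (M N : M4 k) : finM k (M + N) = finM k M + finM k N :=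
  Matrix.map_add (finPart k) (map_add _) M N

/-- the matrix of the inverse of a norm-one scalar unitary is the conjugate scalar -/
theorem mat_escGA_inv {d : k} (hΩ : W.Ω * W.Ω = -(d • (1 : Matrix (Fin 4) (Fin 4) k)))
    (hΩB : W.Ω * W.B = -(W.B * W.Ωᵀ)) (x y : Ad k) (h : nrm d x y = 1) :
    GA.mat W (escGA W hΩ hΩB x y h)⁻¹ = esc W x (-y) := rfl

/-- `esc x y * esc x′ (−y′)`, coordinatewise -/
theorem esc_mul_esc_neg {d : k} (hΩ : W.Ω * W.Ω = -(d • (1 : Matrix (Fin 4) (Fin 4) k))) (x y x' y' : Ad k) :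
    esc W x y * esc W x' (-y') =
      esc W (x * x' + algebraMap k (Ad k) d * (y * y')) (-(x * y' - y * x')) := by
  rw [esc_mul_esc W hΩ]
  congr 1 <;> ring

end FinitePartBridge

/-! ## 9. The compact sets `{g : mat g ∈ K, mat g⁻¹ ∈ K′}` of `G(𝔸)` -/

section Tori

/-- the set of `g ∈ G(𝔸)` whose matrix and inverse matrix lie in given compact sets is compact (the closed embedding
`g ↦ (g, g⁻¹)` into `M₄ × M₄ᵐᵒᵖ`) -/
theorem isCompact_setOf_mat_mem {K K' : Set (M4 k)} (hK : IsCompact K) (hK' : IsCompact K') :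
    IsCompact {g : GA W | GA.mat W g ∈ K ∧ GA.mat W g⁻¹ ∈ K'} := by
  have h : {g : GA W | GA.mat W g ∈ K ∧ GA.mat W g⁻¹ ∈ K'} =
      (fun g : GA W => Units.embedProduct (M4 k) (g : GL4 k)) ⁻¹' (K ×ˢ (MulOpposite.op '' K')) := by
    ext g
    change _ ↔ (((g : GL4 k) : M4 k), MulOpposite.op (((g : GL4 k)⁻¹ : GL4 k) : M4 k)) ∈ K ×ˢ (MulOpposite.op '' K')
    rw [Set.mem_prod, MulOpposite.op_injective.mem_set_image]
    exact Iff.rfl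
  rw [h]
  exact (isClosedEmbedding_embed W).isCompact_preimage (hK.prod (hK'.image MulOpposite.continuous_op))

end Tori

/-! ## 10. Scalar algebra of the decompositions -/

section Algebra

/-- right multiplication of a decomposition by a scalar -/
theorem decomp_mul_esc {d : k} (hΩ : W.Ω * W.Ω = -(d • (1 : Matrix (Fin 4) (Fin 4) k)))
    (P : Fin 2 → Matrix (Fin 4) (Fin 4) k) (hPΩ : ∀ i, P i * W.Ω = W.Ω * P i) (x y : Fin 2 → Ad k) (x' y' : Ad k) :
    (esc W (x 0) (y 0) * adMat k (P 0) + esc W (x 1) (y 1) * adMat k (P 1)) * esc W x' (-y') =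
      esc W (x 0 * x' + algebraMap k (Ad k) d * (y 0 * y')) (-(x 0 * y' - y 0 * x')) * adMat k (P 0) +
        esc W (x 1 * x' + algebraMap k (Ad k) d * (y 1 * y')) (-(x 1 * y' - y 1 * x')) * adMat k (P 1) := by
  rw [add_mul, mul_assoc, mul_assoc, ← esc_mul_adMat_comm W _ _ (hPΩ 0), ← esc_mul_adMat_comm W _ _ (hPΩ 1),
    ← mul_assoc, ← mul_assoc, esc_mul_esc_neg W hΩ, esc_mul_esc_neg W hΩ]

/-- left multiplication of a conjugate decomposition by a scalar -/
theorem esc_mul_decomp_conj {d : k} (hΩ : W.Ω * W.Ω = -(d • (1 : Matrix (Fin 4) (Fin 4) k)))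
    (P : Fin 2 → Matrix (Fin 4) (Fin 4) k) (x y : Fin 2 → Ad k) (x' y' : Ad k) :
    esc W x' y' * (esc W (x 0) (-y 0) * adMat k (P 0) + esc W (x 1) (-y 1) * adMat k (P 1)) =
      esc W (x 0 * x' + algebraMap k (Ad k) d * (y 0 * y')) (x 0 * y' - y 0 * x') * adMat k (P 0) +
        esc W (x 1 * x' + algebraMap k (Ad k) d * (y 1 * y')) (x 1 * y' - y 1 * x') * adMat k (P 1) := by
  rw [mul_add, ← mul_assoc, ← mul_assoc, esc_mul_esc_neg W hΩ, esc_mul_esc_neg W hΩ]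
  congr 2 <;> congr 1 <;> ring

end Algebra

end Summit.Ventures.HodgeRepro.Tier4.Line4

end
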